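import Summits.BirchSwinnertonDyer.BirchSwinnertonDyer.Theorems.KatoDescentTamePotSupersingularTameUpperDefectBill
import Summits.BirchSwinnertonDyer.BirchSwinnertonDyer.Theorems.KatoDescentTamePotSupersingularTameUpperDefectOfItems
import Summits.BirchSwinnertonDyer.BirchSwinnertonDyer.Theorems.KatoDescentTamePotSupersingularTameUpperReducibleDefectOfCountInputs
import HarnessLib

/-!
# Route `KatoDescentTamePotSupersingular` (rung K8, sub-rung B4 (t′), cell `bsd-potss`): the U₀ BILL of item
# stmt-BirchSwinnertonDyer-19982 `TameUpperDefectRankZero` AFTER kmc Part 16 and the closed glue 19712 — the item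
# BY NAME from the Conj-A crux 19413 (or one anchor certificate per ♯ row) and HELD CITE-LEVEL ITEMS ONLY, with NO
# reducible residue (a `--supports … --as helper` file; seat `bsd-potss-k8t-c4` g5; nothing booked, BSD is not
# proved by any of this, the item is NOT closed)

What changed since the g4 bill (`…TameUpperDefectBill.lean`, p448428: cites + L₀ + R₁ + crux M + Mazur (7') +
Ogg–Saito + `hcert` + the reducible residue `hodd7`): the REDUCIBLE child `TameUpperReducibleDefect` (crux U₀-red,
item 19203) needs no residue and no crux any more — it is the closed glue `TameUpperReducibleDefectOfCountInputs`
(item 19712, `tameUpperReducibleDefectOfCountInputs_proof`, this seat) applied to its six HELD cite-level children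
`PublishedInputIwasawaH1DataRedT` (Kato's `𝐇¹` data), `PublishedInputNewformKatoRedT` (newform),
`PublishedInputMemberHullCountInputsT` (Kato's SHARP rank-`0` member count, reviewed fact
`Kato2004.exists_memberHullCountInputs`, p448371), `PublishedInputCasselsIsogenyRedT` (Cassels),
`PublishedInputRankEqAnalyticRankRedT` (GZK), `PublishedInputEntireLFunctionRedT` (modularity) — kmc g9's count road
(`tameUpperReducibleDefect_of_memberCountInputs`, p451821). So `h₃` (crux M), `hMz`, `hOS`, `hP` and `hodd7`
DISAPPEAR from the bill:

* §1 **`tameUpperDefectRankZero_of_cruxA_of_heldItems`** — U₀ ⟸ `PublishedInputsFineSelmerCM` (19387) ∧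
  `KatoTamagawaExactInputs` (19191) ∧ the Conj-A crux `TameFineSelmerCoatesSujatha` (19413) ∧ the six held `…RedT`
  children of 19203: **the only non-cite input of U₀ left is crux 19413** (Coates–Sujatha (A) on the non-CM (t′)
  U₀-ns rows — an open problem; g4's «find» verdict NOT FOUND class-wide);
  `tameUpperDefectRankZero_of_cruxA_of_countInputs` — the same with the held children replaced by the three
  Literature facts they ascribe that are not already conjuncts of 19191 / 19198 (`𝐇¹` data, count inputs; Cassels
  from `PublishedInputsTame`).
* §2 **`tameUpperDefectRankZero_bill_of_sharpCertificates_of_countInputs`** — the g4 bill with the reducible half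
  replaced by the count road: U₀ ⟸ {Heegner cites, newform, BFH, 19191, 19387, L₀ = 19981, R₁ = 19984, Lim–Sujatha}
  + ONE mixed congruent certificate per ♯ row of 19413 (`hcert`) + {`𝐇¹` data, count inputs, `PublishedInputsTame`}.

Composition of landed kernel theorems only; CONDITIONAL (audit `proof.conditional`); the item is NOT closed; the
open content of U₀ on (t′) is EXACTLY crux 19413 (resp. the ♯-row anchors). HONEST FRAMING: BSD is not advanced.

References: [Kato2004Asterisque] Thm. 12.5 (p. 222), Thm. 14.5 (3) (p. 236), (14.9.3) (p. 240), Prop. 14.16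
(pp. 244–245); [CoatesSujatha2005] Conj. A; [LimSujatha2018] §3 Prop. 3.2; [BurungaleFlach2024] Thm. 1.1, Cor. 2;
[GrossZagier1986]; [Kolyvagin1990]; [MatarNekovar2019] Thm. 0.3; [BumpFriedbergHoffstein1990];
[Cassels1965ArithmeticVIII].
-/

set_option autoImplicit false
-- sibling precedent (`KatoDescentTamePotSupersingularAssembly.lean`): the directory name repeats the summit name
set_option linter.dupNamespace false

noncomputable section

open scoped Classical

namespace Summit.BirchSwinnertonDyer.BirchSwinnertonDyer.Theorems

open WeierstrassCurve Literature.NumberTheory.EllipticCurves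
  Literature.NumberTheory.EllipticCurves.ModularForms
  Literature.NumberTheory.EllipticCurves.Rank1Residual
  Literature.NumberTheory.EllipticCurves.Rank1Residual.Typed
  Summit.BirchSwinnertonDyer.Rank1Residual
  Summit.BirchSwinnertonDyer.Rank1Residual.Additive
  Summit.BirchSwinnertonDyer.Rank1Residual.O6
  Summit.BirchSwinnertonDyer.BirchSwinnertonDyer.Theses.KatoDescentTamePotSupersingular

/-! ## §1 U₀ from the Conj-A crux and held cite-level items ONLY -/

/-- **U₀ of K8-t′ — item 19982 `TameUpperDefectRankZero` (type = the route decl) — from the route items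
`PublishedInputsFineSelmerCM` (19387, held cites), `KatoTamagawaExactInputs` (19191, held cites), the Conj-A crux
`TameFineSelmerCoatesSujatha` (19413) and the six HELD cite-level children of U₀-red 19203.** Proof:
`tameUpperDefectRankZero_of_items` (g2: split glue 19204 ∘ the fine-Selmer derivation of 19202) with the reducible
child supplied by the closed glue 19712 (`tameUpperReducibleDefectOfCountInputs_proof`). After this seat's g0–g5 the
ONLY input of U₀ that is neither a route-held published fact nor a closed item is crux 19413 (Coates–Sujatha (A) on
the non-CM U₀-ns rows). Conditional over items; nothing asserted; no item is closed.
[cite: Kato2004Asterisque, Thm. 12.5 (p. 222), Thm. 14.5 (3) (p. 236), (14.9.3) (p. 240), Prop. 14.16 (pp. 244–245)]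
[cite: CoatesSujatha2005, Conjecture A] [cite: BurungaleFlach2024, Thm. 1.1 and Cor. 2] [cite: Cassels1965ArithmeticVIII] -/
theorem tameUpperDefectRankZero_of_cruxA_of_heldItems (hF : PublishedInputsFineSelmerCM)
    (hK : KatoTamagawaExactInputs) (hCS : TameFineSelmerCoatesSujatha)
    (hC₁ : PublishedInputIwasawaH1DataRedT) (hC₂ : PublishedInputNewformKatoRedT)
    (hC₃ : PublishedInputMemberHullCountInputsT) (hC₄ : PublishedInputCasselsIsogenyRedT)
    (hC₅ : PublishedInputRankEqAnalyticRankRedT) (hC₆ : PublishedInputEntireLFunctionRedT) :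
    Summit.BirchSwinnertonDyer.BirchSwinnertonDyer.Theses.KatoDescentTamePotSupersingular.TameUpperDefectRankZero :=
  tameUpperDefectRankZero_of_items hF hK hCS (tameUpperReducibleDefectOfCountInputs_proof hC₁ hC₂ hC₃ hC₄ hC₅ hC₆)

/-- **The same with the held children unfolded to Literature facts**: U₀ ⟸ 19387 ∧ 19191 ∧ `PublishedInputsTame`
(19198; conjunct 4 = Cassels) ∧ crux 19413 ∧ Kato's `𝐇¹` data (`Kato2004.nonempty_iwasawaH1Data`) ∧ the newform
(`exists_isNewformOf`) ∧ Kato's sharp member count (`Kato2004.exists_memberHullCountInputs`); GZK and modularity are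
conjuncts 2–3 of 19191. Every `…RedT` alias unfolds definitionally. Conditional; nothing asserted; no item closed.
[cite: Kato2004Asterisque, (14.9.3) (p. 240), Prop. 14.16 (pp. 244–245)] [cite: CoatesSujatha2005, Conjecture A]
[cite: Cassels1965ArithmeticVIII] -/
theorem tameUpperDefectRankZero_of_cruxA_of_countInputs (hF : PublishedInputsFineSelmerCM)
    (hK : KatoTamagawaExactInputs) (hP : PublishedInputsTame) (hCS : TameFineSelmerCoatesSujatha)
    (hne : Kato2004.nonempty_iwasawaH1Data) (hnf : exists_isNewformOf)
    (hin : Kato2004.exists_memberHullCountInputs) :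
    Summit.BirchSwinnertonDyer.BirchSwinnertonDyer.Theses.KatoDescentTamePotSupersingular.TameUpperDefectRankZero :=
  tameUpperDefectRankZero_of_cruxA_of_heldItems hF hK hCS hne hnf hin hP.2.2.2.1 hK.2.1 hK.2.2

/-! ## §2 The g4 bill with the reducible half on the count road: ♯-row certificates + cites, nothing else -/

/-- **THE U₀ BILL (item 19982) after kmc Part 16 / glue 19712.** Granted the published inputs — Heegner cites
(`hGZ`, `hKo`, `hMN`), the newform (`hnf`), Bump–Friedberg–Hoffstein (`hBFH`), `KatoTamagawaExactInputs` (`hK`,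
19191), `PublishedInputsFineSelmerCM` (`hF`, 19387), Lim–Sujatha (`hLS`), Kato's `𝐇¹` data (`hne`), the member count
inputs (`hin`), `PublishedInputsTame` (`hP`, 19198) —, the route's crux L₀ (`h₂`, 19981) and residual R₁ (`hR`,
19984), and ONE mixed congruent certificate per irreducible, tower-deficient, ♯ (`p ∣ ∏c_ℓ` or no Manin-clean
parametrisation), non-CM (t′) row (`hcert`: a curve `W′/ℚ` with `W′[p] ≃ W[p]` carrying (A) at `(W′, p)` OR finite
`Sel_{p^∞}(W′/ℚ^cyc)[p]` for every cyclotomic datum), U₀ holds. g4's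
`tameUpperDefectRankZero_bill_of_sharpCertificates_of_oddParityLeSeven` WITHOUT `h₃` (crux M), `hMz` (Mazur (7')),
`hOS` (Ogg–Saito) and WITHOUT the reducible residue `hodd7`. Composition: split glue 19204 ∘ (§1 of the g4 bill,
Heegner road + ♯ certificates ⟹ 19202) ∘ (glue 19712 ⟹ 19203). Conditional; nothing asserted; no item is closed.
[cite: LimSujatha2018, §3 Prop. 3.2] [cite: MatarNekovar2019, Thm. 0.3] [cite: GrossZagier1986, Thm. I.6.3]
[cite: Kato2004Asterisque, Thm. 14.5 (3) (p. 236), (14.9.3) (p. 240), Prop. 14.16 (pp. 244–245)]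
[cite: CoatesSujatha2005, Conjecture A] [cite: Cassels1965ArithmeticVIII] -/
theorem tameUpperDefectRankZero_bill_of_sharpCertificates_of_countInputs
    (hGZ : ∀ (N : ℕ) [NeZero N] (W : WeierstrassCurve ℚ) (K : Type) [Field K] [NumberField K],
      gross_zagier N W K)
    (hKo : ∀ (N : ℕ) [NeZero N] (W : WeierstrassCurve ℚ) (K : Type) [Field K] [NumberField K],
      kolyvagin N W K)
    (hMN : ∀ (N : ℕ) [NeZero N] (W : WeierstrassCurve ℚ) (K : Type) [Field K] [NumberField K],
      MatarNekovar2019.thm03_padicValNat_card_sha_le_of_irreducible N W K)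
    (hnf : exists_isNewformOf) (hBFH : bumpFriedbergHoffstein_exists_heegnerField_split_twist_simpleZero)
    (hK : KatoTamagawaExactInputs) (hF : PublishedInputsFineSelmerCM) (h₂ : TameLowerHalfRankZero)
    (hR : TameRankOne) (hLS : LimSujatha2018.prop32_fineSelmerDual_moduleFinite_iff_of_torsionIso)
    (hcert : ∀ (W : WeierstrassCurve ℚ) [W.IsElliptic] [W.IsGloballyMinimal] (p : ℕ) [Fact p.Prime],
      W.analyticRank = 0 → p ≠ 2 → Addv W p → SubTprime W p → ¬ W.HasCM →
      W.HasIrreducibleModPGaloisRep p → ¬ W.HasSurjectiveModNGaloisRep p →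
      (p ∣ W.tamagawaProduct ∨ ∀ [NeZero (W.conductorNorm ℤ)]
        (D : ModularParametrizationData W (W.conductorNorm ℤ)), (p : ℤ) ∣ D.c) →
      ∃ (W' : WeierstrassCurve ℚ) (_ : W'.IsElliptic), ModPCongruent W' W p ∧
        ((∀ (κ : ZpExtension ℚ p), κ.IsCyclotomic →
            ∃ (γ : Field.absoluteGaloisGroup ℚ) (D : W'.FineSelmerDualData κ γ),
              Module.Finite ℤ_[p] (RestrictScalars ℤ_[p] (IwasawaAlgebra p) D.X)) ∨
          ∀ (κ : ZpExtension ℚ p), κ.IsCyclotomic → Set.Finite {s : W'.selmerInfty κ | p • s = 0}))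
    (hne : Kato2004.nonempty_iwasawaH1Data) (hin : Kato2004.exists_memberHullCountInputs)
    (hP : PublishedInputsTame) :
    Summit.BirchSwinnertonDyer.BirchSwinnertonDyer.Theses.KatoDescentTamePotSupersingular.TameUpperDefectRankZero :=
  tameUpperDefectOfSplit_proof
    (tameUpperNonsurjTower_of_lower_of_rankOne_of_sharpCertificates hGZ hKo hMN hnf hBFH hK hF h₂ hR hLS hcert)
    (tameUpperReducibleDefectOfCountInputs_proof hne hnf hin hP.2.2.2.1 hK.2.1 hK.2.2) hK

end Summit.BirchSwinnertonDyer.BirchSwinnertonDyer.Theorems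

end
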